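/-
Copyright (c) 2026 the pub-hodgecm-mathlib formalisation cell (harness21).  Prover seat hodgecm-mathlib-F0P3b-p01 (g25); offered to the E1 keeper ∕ dealer
F0P3a-p03 (g30) as row 40⁗δ (his 03:15:07Z census hint on (d2); sigsheet-first, rule 20): the `χ`-line letters of ★ row 40⁗γ from «dim r_P A = 1» alone.
-/
import Literature.NumberTheory.Automorphic.JacquetSelfExtensionOfCharacterLine   -- ★ row 40⁗γ (this seat): `exists_coord_of_finrank_eq_one`, `exists_jacquet_selfExtension_of_selfExtension`
import Literature.NumberTheory.Automorphic.JacquetModuleFrobeniusProofs          -- ★ `Representation.frobenius_normalizedInd_holds` (Frobenius reciprocity for `i_P`)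
import Literature.NumberTheory.Automorphic.SmoothInduction                       -- ★ `Representation.isSmooth_smoothInd`
import Literature.NumberTheory.Automorphic.SmoothRepresentation                  -- ★ `Representation.IsSmooth`, `mem_stabilizerSubgroup`
import HarnessLib

/-!
# A subrepresentation `A ≤ i_P(χ)` with ONE-dimensional Jacquet module: `r_P A` is the `χ`-line, and `r_P` of a self-extension of `A` is a
# self-extension of the `χ`-line

Generic (topological group `G`, parabolic triple `t = (P, M, N)` with `δ_P|_N = 1`, complex coefficients), ★ `JacquetSelfExtensionOfCharacterLine` ∕
`JacquetModuleFrobeniusProofs` ∕ `SmoothInduction` ∕ `SmoothRepresentation` + Mathlib, THEOREMS ONLY (no `def`, no instance, no named fact).  Namespace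
`Literature.NumberTheory.Automorphic`.  Cell `pub/hodgecm-mathlib`, crux H413 = `stmt-HodgeConjecture-24833` (`--supports` lane): for ★ row 40″
`selfExtension_splits_of_jacquet_selfExtension` (letters `t hδ χ χ₁ hχ₁ A hAinv ι p hp hexact`) the hypothesis block (b) «`r_P τ` is a self-extension of the `χ`-line»
now follows from the SINGLE printed input (d2a) «`dim r_P A = 1`» ([Keys1984, §3]; [Rogawski1990, §12.2] for `A = π²(ξ)`): the character by which `M` acts on the line
`r_P A` is forced to be `χ` by Frobenius reciprocity applied to the inclusion `A ↪ i_P(χ)` ([Casselman1995, Prop. 7.1.3]).  Seat F0P3b-p01 (g25).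

THE MATHEMATICS.  (1) A subrepresentation of a smooth representation is smooth (same stabilisers); `i_P(χ₁)` is smooth (★ `isSmooth_smoothInd`).  (2) If `r_P σ` is a line
carrying a NON-ZERO `M`-map `φ` to the character `χ₁ = ℂ_χ`, then `M` acts on `r_P σ` by `χ` (`φ` is injective on the line).  (3) For `A ≤ i_P(χ₁)` invariant and `≠ ⊥` with
`dim r_P A = 1`, the Frobenius image (★ `frobenius_normalizedInd_holds`) of the inclusion `A ↪ i_P(χ₁)` is such a `φ`, so `r_P A` IS the `χ`-line; with ★ (γ)
`exists_coord_of_finrank_eq_one` this gives the `(a₀, qA, hqa₀, hspan, hchar)` letters, and ★ (γ) `exists_jacquet_selfExtension_of_selfExtension` (applied by the consumer) turns a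
self-extension `0 → A —ι→ τ —p→ A → 0` (`r_P ι` injective) into the (b) block `pJ hquot hker u₀ e hu₀ he hline hfree` of the SENTENCE.
* §1 `isSmooth_subrepresentation`, `subrepresentation_subtype_ne_zero`.   * §2 `normalizedJacquet_eq_smul_of_finrank_eq_one_of_intertwiningMap_char`.
* §3 **`normalizedJacquet_subrepresentation_normalizedInd_eq_smul_of_finrank_eq_one`** (`r_P A` is the `χ`-line), **`exists_line_letters_of_finrank_eq_one`** (the
  `(a₀, qA, hqa₀, hspan, hchar)` letters of ★ (γ) from (d2a)); the SENTENCE's (b) block is then ONE application of ★ (γ)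
  `exists_jacquet_selfExtension_of_selfExtension t _ τ χ qA hqa₀ hspan hchar ι p hι hp hexact` (not restated here — the gate's dedup lint identifies the composite with ★ (γ)).
[cite: BernsteinZelevinsky1977, Prop. 1.9 (b); §2.3] [cite: Casselman1995, Thm. 3.2.4; Prop. 7.1.3 p. 67] [cite: Keys1984, §3 pp. 118–119] [cite: BushnellHenniart2006, §1.1]
HONEST LABEL: count-neutral generic layer; HC_CM is proved only modulo the printed citations of that programme until its rung 0 closes.

## References
* [BernsteinZelevinsky1977] I. N. Bernstein, A. V. Zelevinsky, *Induced representations of reductive p-adic groups I*, Ann. Sci. ÉNS 10 (1977), Prop. 1.9 (b), §2.3.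
* [Casselman1995] W. Casselman, *Introduction to the theory of admissible representations of p-adic reductive groups* (1995), Thm. 3.2.4, Prop. 7.1.3 p. 67.
* [Keys1984] D. Keys, *Principal series representations of special unitary groups over local fields*, Compositio Math. 51 (1984), §3 pp. 118–119.
* [BushnellHenniart2006] C. J. Bushnell, G. Henniart, *The Local Langlands Conjecture for GL(2)*, §1.1 (smooth representations, stabilisers).
-/

set_option autoImplicit false

noncomputable section

namespace Literature.NumberTheory.Automorphic

open _root_.Representation

/-! ## §1 Subrepresentations of smooth representations; the inclusion map -/

section Sub

variable {k : Type*} [CommRing k] {G : Type*} [Group G] [TopologicalSpace G] {V : Type*} [AddCommGroup V] [Module k V]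
  (ρ : Representation k G V) (W : Submodule k V) (hW : ∀ g, W ≤ W.comap (ρ g))

/-- **A subrepresentation of a smooth representation is smooth**: the stabiliser of `⟨v, _⟩` in `ρ|_W` is the stabiliser of `v` in `ρ`.
[cite: BushnellHenniart2006, §1.1] -/
theorem isSmooth_subrepresentation (hρ : ρ.IsSmooth) : (ρ.subrepresentation W hW).IsSmooth := by
  intro w
  have hset : ((ρ.subrepresentation W hW).stabilizerSubgroup w : Set G) = (ρ.stabilizerSubgroup (w : V) : Set G) := by
    ext g
    rw [SetLike.mem_coe, SetLike.mem_coe, mem_stabilizerSubgroup, mem_stabilizerSubgroup, Subtype.ext_iff]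
    rfl
  change IsOpen ((ρ.subrepresentation W hW).stabilizerSubgroup w : Set G)
  rw [hset]
  exact hρ (w : V)

omit [TopologicalSpace G] in
/-- The inclusion `W ↪ V` is an intertwining map `ρ|_W → ρ`, and it is NON-ZERO as soon as `W ≠ ⊥`. [cite: BernsteinZelevinsky1977, §2.3] -/
theorem subrepresentation_subtype_ne_zero (hbot : W ≠ ⊥) :
    (⟨W.subtype, fun _ => LinearMap.ext fun _ => rfl⟩ : (ρ.subrepresentation W hW).IntertwiningMap ρ) ≠ 0 := by
  intro h0
  apply hbot
  rw [Submodule.eq_bot_iff]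
  intro v hv
  have := congrArg (fun f : (ρ.subrepresentation W hW).IntertwiningMap ρ => f ⟨v, hv⟩) h0
  simpa using this

end Sub

/-! ## §2 A Jacquet LINE with a non-zero `M`-map to `ℂ_χ`: `M` acts by `χ` -/

section Line

variable {G : Type*} [Group G] [TopologicalSpace G] [IsTopologicalGroup G] (t : ParabolicTriple G) [LocallyCompactSpace ↥t.P]
  (χ : ↥t.M →* ℂ) (χ₁ : Representation ℂ ↥t.M ℂ) (hχ₁ : ∀ (m : ↥t.M) (x : ℂ), χ₁ m x = χ m * x)
  {W : Type*} [AddCommGroup W] [Module ℂ W] (σ : Representation ℂ G W)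

include hχ₁ in
/-- **If `r_P σ` is one-dimensional and carries a NON-ZERO `M`-map to `ℂ_χ`, then `M` acts on `r_P σ` by `χ`** (the map is injective on the line and
intertwines).  Twin of ★ `normalizedJacquet_apply_eq_smul_of_finrank_eq_one` (there for `ℂ_θ = trivial ⊗ θ`, `θ` unit-valued) in the letters `χ₁, hχ₁` of ★ row 40″.
[cite: Casselman1995, Prop. 7.1.3 p. 67] [cite: BernsteinZelevinsky1977, Prop. 1.9 (b)] -/
theorem normalizedJacquet_eq_smul_of_finrank_eq_one_of_intertwiningMap_char (h1 : Module.finrank ℂ (t.restrict σ).Coinvariants = 1)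
    (φ : (σ.normalizedJacquet t).IntertwiningMap χ₁) (hφ : φ ≠ 0) (m : ↥t.M) (x : (t.restrict σ).Coinvariants) :
    σ.normalizedJacquet t m x = χ m • x := by
  haveI : FiniteDimensional ℂ (t.restrict σ).Coinvariants := Module.finite_of_finrank_eq_succ h1
  have hφinj : Function.Injective φ := by
    have hker : LinearMap.ker φ.toLinearMap ≠ ⊤ := by
      intro htop
      apply hφ
      refine Representation.IntertwiningMap.ext (LinearMap.ext fun y => ?_)
      have hy : y ∈ LinearMap.ker φ.toLinearMap := htop ▸ Submodule.mem_top
      simpa using hy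
    have hker0 : LinearMap.ker φ.toLinearMap = ⊥ := by
      haveI := is_simple_module_of_finrank_eq_one (K := ℂ) (A := ℂ) h1
      rcases IsSimpleOrder.eq_bot_or_eq_top (LinearMap.ker φ.toLinearMap) with h0 | h0
      · exact h0
      · exact (hker h0).elim
    exact LinearMap.ker_eq_bot.1 hker0
  apply hφinj
  rw [map_smul, Representation.IntertwiningMap.isIntertwining, hχ₁, smul_eq_mul]

end Line

/-! ## §3 `A ≤ i_P(χ₁)` with `dim r_P A = 1`: `r_P A` is the `χ`-line; `r_P` of a self-extension of `A` -/

section InducedLine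

variable {G : Type*} [Group G] [TopologicalSpace G] [IsTopologicalGroup G] (t : ParabolicTriple G) [LocallyCompactSpace ↥t.P]
  (hδ : ∀ (n : G) (hn : n ∈ t.N), deltaChar t.P ⟨n, t.N_le hn⟩ = 1)
  (χ : ↥t.M →* ℂ) (χ₁ : Representation ℂ ↥t.M ℂ) (hχ₁ : ∀ (m : ↥t.M) (x : ℂ), χ₁ m x = χ m * x)
  (A : Submodule ℂ (SmoothInd t.P (Representation.twist (χ₁.comp t.proj) (rootDeltaChar t.P))))
  (hAinv : ∀ g, A ≤ A.comap (Representation.normalizedInd t χ₁ g)) (hA : A ≠ ⊥)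
  (h1 : Module.finrank ℂ (t.restrict ((Representation.normalizedInd t χ₁).subrepresentation A hAinv)).Coinvariants = 1)

include hδ hχ₁ hA h1 in
/-- **`r_P A` IS THE `χ`-LINE** for an invariant `A ≤ i_P(χ₁)`, `A ≠ ⊥`, with `dim r_P A = 1`: the Frobenius image (★ `frobenius_normalizedInd_holds`; `A` is smooth by §1 + ★
`isSmooth_smoothInd`) of the inclusion `A ↪ i_P(χ₁)` is a non-zero `M`-map `r_P A → ℂ_χ`, and §2 applies.
[cite: Casselman1995, Thm. 3.2.4; Prop. 7.1.3 p. 67] [cite: BernsteinZelevinsky1977, Prop. 1.9 (b)] [cite: Keys1984, §3 pp. 118–119] -/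
theorem normalizedJacquet_subrepresentation_normalizedInd_eq_smul_of_finrank_eq_one (m : ↥t.M)
    (x : (t.restrict ((Representation.normalizedInd t χ₁).subrepresentation A hAinv)).Coinvariants) :
    ((Representation.normalizedInd t χ₁).subrepresentation A hAinv).normalizedJacquet t m x = χ m • x := by
  have hsm : ((Representation.normalizedInd t χ₁).subrepresentation A hAinv).IsSmooth :=
    isSmooth_subrepresentation _ A hAinv (isSmooth_smoothInd _ _)
  obtain ⟨Φ⟩ := Representation.frobenius_normalizedInd_holds t hδ ((Representation.normalizedInd t χ₁).subrepresentation A hAinv) χ₁ hsm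
  have hf := subrepresentation_subtype_ne_zero (Representation.normalizedInd t χ₁) A hAinv hA
  exact normalizedJacquet_eq_smul_of_finrank_eq_one_of_intertwiningMap_char t χ χ₁ hχ₁ _ h1 (Φ _) (fun h0 => hf (Φ.map_eq_zero_iff.1 h0)) m x

include hδ hχ₁ hA h1 in
/-- **THE `χ`-LINE LETTERS OF `r_P A`** (`a₀`, `qA`, `qA a₀ = 1`, `w = qA w • a₀`, `r_P A (m) a₀ = χ(m) a₀`) from `dim r_P A = 1` — the input of ★ (γ).
[cite: Casselman1995, Prop. 7.1.3 p. 67] [cite: Keys1984, §3 pp. 118–119] -/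
theorem exists_line_letters_of_finrank_eq_one :
    ∃ (a₀ : (t.restrict ((Representation.normalizedInd t χ₁).subrepresentation A hAinv)).Coinvariants)
      (qA : (t.restrict ((Representation.normalizedInd t χ₁).subrepresentation A hAinv)).Coinvariants →ₗ[ℂ] ℂ),
      qA a₀ = 1 ∧ (∀ w, w = qA w • a₀) ∧ ∀ m : ↥t.M, ((Representation.normalizedInd t χ₁).subrepresentation A hAinv).normalizedJacquet t m a₀ = χ m • a₀ := by
  obtain ⟨a₀, qA, hqa₀, hspan⟩ := exists_coord_of_finrank_eq_one h1
  exact ⟨a₀, qA, hqa₀, hspan, fun m => normalizedJacquet_subrepresentation_normalizedInd_eq_smul_of_finrank_eq_one t hδ χ χ₁ hχ₁ A hAinv hA h1 m a₀⟩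

end InducedLine

end Literature.NumberTheory.Automorphic

end
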